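import Summits.Ventures.PercRepro.S1DisjointSumCircuitTools
import Summits.Ventures.PercRepro.SixFourFinal
import Summits.Ventures.PercRepro.SevenThreeQThree
import Summits.Ventures.PercRepro.PhiCredit
import Summits.Ventures.PercRepro.RankLevelSetO

/-!
# PercRepro — THE CIRCUIT-SUMMAND CONSUMER AT `(8, 4)`: EVERY CIRCUIT SUMMAND (p2, gen 28; SUBCLAIM-S1
§6.10 (xvii))

**C-025 at `(8, 4)` holds on `M ⊕ N` whenever `N` is a circuit of `s + 1 ≥ 3` elements and `M` is a coloop-free
matroid of rank `8 − s`** (coloop-freeness is used only for the triangle and the `4`-circuit). Four cases on the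
circuit size, each from `S1DisjointSumCircuitTools` (`#U ≤ N_M(r, 4) + (s + 1) N_M(r, 3)`) and the slices of
`#Y` that matter, `Φ(8, 4) = 76/15`:
* triangle (`s = 2`, `r = 6`): `#Y ≥ 4 f_M(6) + 8 f_M(5) + 7 f_M(4)`; the tree cells `(6, 4)`, `(6, 3)` of `M`
  and the double count `2 f_M(5) ≤ 6 f_M(6)`;
* `4`-circuit (`s = 3`, `r = 5`): `#Y ≥ 11 f_M(5) + 15 f_M(4)`; `N_M(5, 4) ≤ f_M(5)`, the tree cell `(5, 3)`
  and the double count `2 f_M(4) ≤ 5 f_M(5)`;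
* `5`-circuit (`s = 4`, `r = 4`): `#Y ≥ 25 f_M(4) + 26 f_M(3)`; `N_M(4, 4) + N_M(4, 3) ≤ f_M(4)` and
  `N_M(4, 3) ≤ f_M(3)` — counting alone;
* circuits of `s + 1 ≥ 6` elements (`r ≤ 3`): `#U ≤ (s + 1) f_M(r)`,
  `#Y ≥ f_M(r) (C(s+1, s−3) + C(s+1, s−2) + C(s+1, s−1))` and `76 (s + 1) ≤ 15 (…)` for `5 ≤ s ≤ 8`.
Nothing else is claimed about any cell (the cell `(8, 4)` itself stays open).

* `ncard_Y_eight_four_triangle_ge`, `…_circuit_four_ge`, `…_circuit_five_ge`, `…_large_ge` — the `Y`-sides;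
  `binomial_sum_eight_four`;
* `c025_eight_four_disjointSum_triangle`, `…_circuit_four`, `…_circuit_five`, `…_circuit_large` — the consumers;
* **`c025_eight_four_disjointSum_circuit`** — every circuit summand.
Axioms: standard.
-/

open scoped Matroid

namespace PercRepro

namespace S1

open Set

variable {α : Type}

/-- The `Y`-side at `(8, 4)`, triangle summand: `#Y ≥ 4 f_M(6) + 8 f_M(5) + 7 f_M(4)`. -/
theorem ncard_Y_eight_four_triangle_ge (M N : Matroid α) [M.Finite] [N.Finite] (h : Disjoint M.E N.E)
    (hN : N.IsCircuit N.E) (hN3 : N.E.ncard = 3) :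
    4 * (rankSet M 6).ncard + 8 * (rankSet M 5).ncard + 7 * (rankSet M 4).ncard ≤
      {A : Set α | A ⊆ (M.disjointSum N h).E ∧ ((4 : ℕ) : ℕ∞) < (M.disjointSum N h).eRk A ∧
        (M.disjointSum N h).eRk A < ((8 : ℕ) : ℕ∞)}.ncard := by
  have hN3' : N.E.ncard = 2 + 1 := hN3
  rw [disjointSum_ncard_Y_eq_finsum M N h 8 4, finsum_mem_coe_finset]
  have hsub : ({(6, 0), (6, 1), (5, 0), (5, 1), (5, 2), (4, 1), (4, 2)} : Finset (ℕ × ℕ)) ⊆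
      (Finset.range 8 ×ˢ Finset.range 8).filter (fun x : ℕ × ℕ => 4 < x.1 + x.2 ∧ x.1 + x.2 < 8) := by
    decide
  refine le_trans ?_ (Finset.sum_le_sum_of_subset hsub)
  rw [Finset.sum_insert (by decide), Finset.sum_insert (by decide), Finset.sum_insert (by decide),
    Finset.sum_insert (by decide), Finset.sum_insert (by decide), Finset.sum_insert (by decide),
    Finset.sum_singleton]
  dsimp only
  have f0 : 1 ≤ (rankSet N 0).ncard := by
    have := choose_le_ncard_rankSet_of_isCircuit_ground hN hN3' (a := 0) (by norm_num)
    rwa [Nat.choose_zero_right] at this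
  have f1 : 3 ≤ (rankSet N 1).ncard := by
    have := choose_le_ncard_rankSet_of_isCircuit_ground hN hN3' (a := 1) (by norm_num)
    rwa [Nat.choose_one_right] at this
  have f2 : 4 ≤ (rankSet N 2).ncard := ncard_rankSet_top_of_isCircuit_ground hN hN3'
  have e60 := Nat.mul_le_mul_left (rankSet M 6).ncard f0
  have e61 := Nat.mul_le_mul_left (rankSet M 6).ncard f1
  have e50 := Nat.mul_le_mul_left (rankSet M 5).ncard f0
  have e51 := Nat.mul_le_mul_left (rankSet M 5).ncard f1
  have e52 := Nat.mul_le_mul_left (rankSet M 5).ncard f2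
  have e41 := Nat.mul_le_mul_left (rankSet M 4).ncard f1
  have e42 := Nat.mul_le_mul_left (rankSet M 4).ncard f2
  linarith

/-- The `Y`-side at `(8, 4)`, `4`-circuit summand: `#Y ≥ 11 f_M(5) + 15 f_M(4)`. -/
theorem ncard_Y_eight_four_circuit_four_ge (M N : Matroid α) [M.Finite] [N.Finite] (h : Disjoint M.E N.E)
    (hN : N.IsCircuit N.E) (hN4 : N.E.ncard = 4) :
    11 * (rankSet M 5).ncard + 15 * (rankSet M 4).ncard ≤
      {A : Set α | A ⊆ (M.disjointSum N h).E ∧ ((4 : ℕ) : ℕ∞) < (M.disjointSum N h).eRk A ∧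
        (M.disjointSum N h).eRk A < ((8 : ℕ) : ℕ∞)}.ncard := by
  have hN4' : N.E.ncard = 3 + 1 := hN4
  rw [disjointSum_ncard_Y_eq_finsum M N h 8 4, finsum_mem_coe_finset]
  have hsub : ({(5, 0), (5, 1), (5, 2), (4, 1), (4, 2), (4, 3)} : Finset (ℕ × ℕ)) ⊆
      (Finset.range 8 ×ˢ Finset.range 8).filter (fun x : ℕ × ℕ => 4 < x.1 + x.2 ∧ x.1 + x.2 < 8) := by
    decide
  refine le_trans ?_ (Finset.sum_le_sum_of_subset hsub)
  rw [Finset.sum_insert (by decide), Finset.sum_insert (by decide), Finset.sum_insert (by decide),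
    Finset.sum_insert (by decide), Finset.sum_insert (by decide), Finset.sum_singleton]
  dsimp only
  have f0 : 1 ≤ (rankSet N 0).ncard := by
    have := choose_le_ncard_rankSet_of_isCircuit_ground hN hN4' (a := 0) (by norm_num)
    rwa [Nat.choose_zero_right] at this
  have f1 : 4 ≤ (rankSet N 1).ncard := by
    have := choose_le_ncard_rankSet_of_isCircuit_ground hN hN4' (a := 1) (by norm_num)
    rwa [Nat.choose_one_right] at this
  have f2 : 6 ≤ (rankSet N 2).ncard := by
    have := choose_le_ncard_rankSet_of_isCircuit_ground hN hN4' (a := 2) (by norm_num)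
    rwa [show Nat.choose (3 + 1) 2 = 6 by decide] at this
  have f3 : 5 ≤ (rankSet N 3).ncard := ncard_rankSet_top_of_isCircuit_ground hN hN4'
  have e50 := Nat.mul_le_mul_left (rankSet M 5).ncard f0
  have e51 := Nat.mul_le_mul_left (rankSet M 5).ncard f1
  have e52 := Nat.mul_le_mul_left (rankSet M 5).ncard f2
  have e41 := Nat.mul_le_mul_left (rankSet M 4).ncard f1
  have e42 := Nat.mul_le_mul_left (rankSet M 4).ncard f2
  have e43 := Nat.mul_le_mul_left (rankSet M 4).ncard f3
  linarith

/-- The `Y`-side at `(8, 4)`, `5`-circuit summand: `#Y ≥ 25 f_M(4) + 26 f_M(3)`. -/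
theorem ncard_Y_eight_four_circuit_five_ge (M N : Matroid α) [M.Finite] [N.Finite] (h : Disjoint M.E N.E)
    (hN : N.IsCircuit N.E) (hN5 : N.E.ncard = 5) :
    25 * (rankSet M 4).ncard + 26 * (rankSet M 3).ncard ≤
      {A : Set α | A ⊆ (M.disjointSum N h).E ∧ ((4 : ℕ) : ℕ∞) < (M.disjointSum N h).eRk A ∧
        (M.disjointSum N h).eRk A < ((8 : ℕ) : ℕ∞)}.ncard := by
  have hN5' : N.E.ncard = 4 + 1 := hN5
  rw [disjointSum_ncard_Y_eq_finsum M N h 8 4, finsum_mem_coe_finset]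
  have hsub : ({(4, 1), (4, 2), (4, 3), (3, 2), (3, 3), (3, 4)} : Finset (ℕ × ℕ)) ⊆
      (Finset.range 8 ×ˢ Finset.range 8).filter (fun x : ℕ × ℕ => 4 < x.1 + x.2 ∧ x.1 + x.2 < 8) := by
    decide
  refine le_trans ?_ (Finset.sum_le_sum_of_subset hsub)
  rw [Finset.sum_insert (by decide), Finset.sum_insert (by decide), Finset.sum_insert (by decide),
    Finset.sum_insert (by decide), Finset.sum_insert (by decide), Finset.sum_singleton]
  dsimp only
  have f1 : 5 ≤ (rankSet N 1).ncard := by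
    have := choose_le_ncard_rankSet_of_isCircuit_ground hN hN5' (a := 1) (by norm_num)
    rwa [Nat.choose_one_right] at this
  have f2 : 10 ≤ (rankSet N 2).ncard := by
    have := choose_le_ncard_rankSet_of_isCircuit_ground hN hN5' (a := 2) (by norm_num)
    rwa [show Nat.choose (4 + 1) 2 = 10 by decide] at this
  have f3 : 10 ≤ (rankSet N 3).ncard := by
    have := choose_le_ncard_rankSet_of_isCircuit_ground hN hN5' (a := 3) (by norm_num)
    rwa [show Nat.choose (4 + 1) 3 = 10 by decide] at this
  have f4 : 6 ≤ (rankSet N 4).ncard := ncard_rankSet_top_of_isCircuit_ground hN hN5'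
  have e41 := Nat.mul_le_mul_left (rankSet M 4).ncard f1
  have e42 := Nat.mul_le_mul_left (rankSet M 4).ncard f2
  have e43 := Nat.mul_le_mul_left (rankSet M 4).ncard f3
  have e32 := Nat.mul_le_mul_left (rankSet M 3).ncard f2
  have e33 := Nat.mul_le_mul_left (rankSet M 3).ncard f3
  have e34 := Nat.mul_le_mul_left (rankSet M 3).ncard f4
  linarith

/-- The `Y`-side at `(8, 4)`, circuit of `s + 1 ≥ 6` elements, `r + s = 8`:
`#Y ≥ f_M(r) · (C(s+1, s−3) + C(s+1, s−2) + C(s+1, s−1))`. -/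
theorem ncard_Y_eight_four_large_ge (M N : Matroid α) [M.Finite] [N.Finite] (h : Disjoint M.E N.E)
    {r s : ℕ} (hrs : r + s = 8) (hs : 5 ≤ s) (hN : N.IsCircuit N.E) (hNs : N.E.ncard = s + 1) :
    (rankSet M r).ncard * (Nat.choose (s + 1) (s - 3) + Nat.choose (s + 1) (s - 2) +
        Nat.choose (s + 1) (s - 1)) ≤
      {A : Set α | A ⊆ (M.disjointSum N h).E ∧ ((4 : ℕ) : ℕ∞) < (M.disjointSum N h).eRk A ∧
        (M.disjointSum N h).eRk A < ((8 : ℕ) : ℕ∞)}.ncard := by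
  rw [disjointSum_ncard_Y_eq_finsum M N h 8 4, finsum_mem_coe_finset]
  have hsub : ({(r, s - 3), (r, s - 2), (r, s - 1)} : Finset (ℕ × ℕ)) ⊆
      (Finset.range 8 ×ˢ Finset.range 8).filter (fun x : ℕ × ℕ => 4 < x.1 + x.2 ∧ x.1 + x.2 < 8) := by
    intro x hx
    simp only [Finset.mem_insert, Finset.mem_singleton] at hx
    simp only [Finset.mem_filter, Finset.mem_product, Finset.mem_range]
    rcases hx with rfl | rfl | rfl <;> (dsimp only; omega)
  refine le_trans ?_ (Finset.sum_le_sum_of_subset hsub)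
  rw [Finset.sum_insert (by simp only [Finset.mem_insert, Finset.mem_singleton, Prod.mk.injEq]; omega),
    Finset.sum_insert (by simp only [Finset.mem_singleton, Prod.mk.injEq]; omega), Finset.sum_singleton]
  dsimp only
  have f3 := choose_le_ncard_rankSet_of_isCircuit_ground hN hNs (a := s - 3) (by omega)
  have f2 := choose_le_ncard_rankSet_of_isCircuit_ground hN hNs (a := s - 2) (by omega)
  have f1 := choose_le_ncard_rankSet_of_isCircuit_ground hN hNs (a := s - 1) (by omega)
  have e3 := Nat.mul_le_mul_left (rankSet M r).ncard f3
  have e2 := Nat.mul_le_mul_left (rankSet M r).ncard f2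
  have e1 := Nat.mul_le_mul_left (rankSet M r).ncard f1
  linarith

/-- `76 (s + 1) ≤ 15 (C(s+1, s−3) + C(s+1, s−2) + C(s+1, s−1))` for `5 ≤ s ≤ 8`. -/
theorem binomial_sum_eight_four {s : ℕ} (hs : 5 ≤ s) (hs8 : s ≤ 8) :
    76 * (s + 1) ≤ 15 * (Nat.choose (s + 1) (s - 3) + Nat.choose (s + 1) (s - 2) +
      Nat.choose (s + 1) (s - 1)) := by
  interval_cases s <;> decide

/-- The arithmetic of the triangle consumer at `(8, 4)`. -/
theorem consumer_arith_eight_four_triangle {u y P4 P3 f4 f5 f6 : ℚ} (hU : u ≤ P4 + 3 * P3)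
    (h64 : 6 / 5 * P4 ≤ f5) (h63 : 3 * P3 ≤ f4 + f5) (hdc : 2 * f5 ≤ (5 + 1) * f6)
    (hY : 4 * f6 + 8 * f5 + 7 * f4 ≤ y) (hf4 : 0 ≤ f4) (hf6 : 0 ≤ f6) : 76 / 15 * u ≤ y := by
  linarith

/-- The arithmetic of the `4`-circuit consumer at `(8, 4)`. -/
theorem consumer_arith_eight_four_circuit_four {u y P4 P3 f4 f5 : ℚ} (hU : u ≤ P4 + 4 * P3)
    (hP4 : P4 ≤ f5) (h53 : 5 / 4 * P3 ≤ f4) (hdc : 2 * f4 ≤ (4 + 1) * f5)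
    (hY : 11 * f5 + 15 * f4 ≤ y) (hf4 : 0 ≤ f4) : 76 / 15 * u ≤ y := by
  linarith

/-- The arithmetic of the `5`-circuit consumer at `(8, 4)`. -/
theorem consumer_arith_eight_four_circuit_five {u y P4 P3 f4 f3 : ℚ} (hU : u ≤ P4 + 5 * P3)
    (hsum : P4 + P3 ≤ f4) (hP3 : P3 ≤ f3) (hY : 25 * f4 + 26 * f3 ≤ y) (hf4 : 0 ≤ f4) (hf3 : 0 ≤ f3) :
    76 / 15 * u ≤ y := by
  linarith

/-- The arithmetic of the large-circuit consumer at `(8, 4)`: `76 u ≤ 15 y` gives `(76/15) u ≤ y`. -/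
theorem consumer_arith_eight_four_large {u y : ℚ} (h : 76 * u ≤ 15 * y) : 76 / 15 * u ≤ y := by
  linarith

/-- **The triangle consumer at `(8, 4)`**: coloop-free `M` of rank `6`, `N` a `3`-circuit — from the tree
cells `(6, 4)`, `(6, 3)` and the double count. -/
theorem c025_eight_four_disjointSum_triangle (M N : Matroid α) [M.Finite] [N.Finite]
    (h : Disjoint M.E N.E) (hM : M.eRank = ((6 : ℕ) : ℕ∞)) (hcol : M.coloops = ∅) (hN : N.IsCircuit N.E)
    (hN3 : N.E.ncard = 3) :
    phiK 8 4 * ({A : Set α | A ⊆ (M.disjointSum N h).E ∧ (M.disjointSum N h).eRk A = ((8 : ℕ) : ℕ∞) ∧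
        (M.disjointSum N h).eRk ((M.disjointSum N h).E \ A) = ((4 : ℕ) : ℕ∞)}.ncard : ℚ) ≤
      ({A : Set α | A ⊆ (M.disjointSum N h).E ∧ ((4 : ℕ) : ℕ∞) < (M.disjointSum N h).eRk A ∧
        (M.disjointSum N h).eRk A < ((8 : ℕ) : ℕ∞)}.ncard : ℚ) := by
  have hU := ncard_U_disjointSum_circuit_le M N h (p := 8) (r := 6) (s := 2) rfl (by norm_num) hM hN hN3
  have hY := ncard_Y_eight_four_triangle_ge M N h hN hN3
  have h64 : (6 / 5 : ℚ) * ((profileSet M 6 4).ncard : ℚ) ≤ ((rankSet M 5).ncard : ℚ) := by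
    have h0 := SixFour.rls_six_four_holds M
    unfold ThmN.RLS at h0
    rw [phiK_six_four, ySet_eq_rankSet_of_eq M (q := 4) (p := 6) (k := 5) rfl rfl] at h0
    exact h0
  have h63 : (3 : ℚ) * ((profileSet M 6 3).ncard : ℚ) ≤
      ((rankSet M 4).ncard : ℚ) + ((rankSet M 5).ncard : ℚ) := by
    have h0 := SevenThree.c025_three_all M 6 (by norm_num)
    unfold ThmN.RLS at h0
    rw [phiK_six_three, ySet_eq_rankSet_union_of_eq M (q := 3) (p := 6) (k := 4) (k' := 5) rfl rfl rfl,
      ncard_union_eq (rankSet_disjoint_of_ne M (by norm_num)) (rankSet_finite M 4) (rankSet_finite M 5)] at h0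
    push_cast at h0
    exact h0
  have hM' : M.eRank = ((5 + 1 : ℕ) : ℕ∞) := hM
  have hdc := two_mul_ncard_rankSet_le M hM' hcol
  rw [phiK_eight_four]
  have hU' : (({A : Set α | A ⊆ (M.disjointSum N h).E ∧ (M.disjointSum N h).eRk A = ((8 : ℕ) : ℕ∞) ∧
      (M.disjointSum N h).eRk ((M.disjointSum N h).E \ A) = ((4 : ℕ) : ℕ∞)}.ncard : ℕ) : ℚ) ≤
      ((profileSet M 6 4).ncard : ℚ) + 3 * ((profileSet M 6 3).ncard : ℚ) := by
    have hU2 : ({A : Set α | A ⊆ (M.disjointSum N h).E ∧ (M.disjointSum N h).eRk A = ((8 : ℕ) : ℕ∞) ∧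
        (M.disjointSum N h).eRk ((M.disjointSum N h).E \ A) = ((4 : ℕ) : ℕ∞)}.ncard : ℕ) ≤
        (profileSet M 6 4).ncard + 3 * (profileSet M 6 3).ncard := hU
    exact_mod_cast hU2
  have hY' : 4 * ((rankSet M 6).ncard : ℚ) + 8 * ((rankSet M 5).ncard : ℚ) + 7 * ((rankSet M 4).ncard : ℚ) ≤
      (({A : Set α | A ⊆ (M.disjointSum N h).E ∧ ((4 : ℕ) : ℕ∞) < (M.disjointSum N h).eRk A ∧
        (M.disjointSum N h).eRk A < ((8 : ℕ) : ℕ∞)}.ncard : ℕ) : ℚ) := by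
    exact_mod_cast hY
  have hdc' : 2 * ((rankSet M 5).ncard : ℚ) ≤ (5 + 1) * ((rankSet M 6).ncard : ℚ) := by
    exact_mod_cast hdc
  have hf4 : (0 : ℚ) ≤ ((rankSet M 4).ncard : ℚ) := Nat.cast_nonneg _
  have hf6 : (0 : ℚ) ≤ ((rankSet M 6).ncard : ℚ) := Nat.cast_nonneg _
  exact consumer_arith_eight_four_triangle hU' h64 h63 hdc' hY' hf4 hf6

/-- **The `4`-circuit consumer at `(8, 4)`**: coloop-free `M` of rank `5`, `N` a `4`-circuit — from the tree
cell `(5, 3)` and the double count. -/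
theorem c025_eight_four_disjointSum_circuit_four (M N : Matroid α) [M.Finite] [N.Finite]
    (h : Disjoint M.E N.E) (hM : M.eRank = ((5 : ℕ) : ℕ∞)) (hcol : M.coloops = ∅) (hN : N.IsCircuit N.E)
    (hN4 : N.E.ncard = 4) :
    phiK 8 4 * ({A : Set α | A ⊆ (M.disjointSum N h).E ∧ (M.disjointSum N h).eRk A = ((8 : ℕ) : ℕ∞) ∧
        (M.disjointSum N h).eRk ((M.disjointSum N h).E \ A) = ((4 : ℕ) : ℕ∞)}.ncard : ℚ) ≤
      ({A : Set α | A ⊆ (M.disjointSum N h).E ∧ ((4 : ℕ) : ℕ∞) < (M.disjointSum N h).eRk A ∧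
        (M.disjointSum N h).eRk A < ((8 : ℕ) : ℕ∞)}.ncard : ℚ) := by
  have hU := ncard_U_disjointSum_circuit_le M N h (p := 8) (r := 5) (s := 3) rfl (by norm_num) hM hN hN4
  have hY := ncard_Y_eight_four_circuit_four_ge M N h hN hN4
  have hP4 := ncard_le_ncard (profileSet_subset_rankSet M 5 4) (rankSet_finite M 5)
  have h53 : (5 / 4 : ℚ) * ((profileSet M 5 3).ncard : ℚ) ≤ ((rankSet M 4).ncard : ℚ) := by
    have h0 := SevenThree.c025_three_all M 5 (by norm_num)
    unfold ThmN.RLS at h0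
    rw [ThmO.phiK_five_three, ySet_eq_rankSet_of_eq M (q := 3) (p := 5) (k := 4) rfl rfl] at h0
    exact h0
  have hM' : M.eRank = ((4 + 1 : ℕ) : ℕ∞) := hM
  have hdc := two_mul_ncard_rankSet_le M hM' hcol
  rw [phiK_eight_four]
  have hU' : (({A : Set α | A ⊆ (M.disjointSum N h).E ∧ (M.disjointSum N h).eRk A = ((8 : ℕ) : ℕ∞) ∧
      (M.disjointSum N h).eRk ((M.disjointSum N h).E \ A) = ((4 : ℕ) : ℕ∞)}.ncard : ℕ) : ℚ) ≤
      ((profileSet M 5 4).ncard : ℚ) + 4 * ((profileSet M 5 3).ncard : ℚ) := by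
    have hU2 : ({A : Set α | A ⊆ (M.disjointSum N h).E ∧ (M.disjointSum N h).eRk A = ((8 : ℕ) : ℕ∞) ∧
        (M.disjointSum N h).eRk ((M.disjointSum N h).E \ A) = ((4 : ℕ) : ℕ∞)}.ncard : ℕ) ≤
        (profileSet M 5 4).ncard + 4 * (profileSet M 5 3).ncard := hU
    exact_mod_cast hU2
  have hY' : 11 * ((rankSet M 5).ncard : ℚ) + 15 * ((rankSet M 4).ncard : ℚ) ≤
      (({A : Set α | A ⊆ (M.disjointSum N h).E ∧ ((4 : ℕ) : ℕ∞) < (M.disjointSum N h).eRk A ∧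
        (M.disjointSum N h).eRk A < ((8 : ℕ) : ℕ∞)}.ncard : ℕ) : ℚ) := by
    exact_mod_cast hY
  have hP4' : ((profileSet M 5 4).ncard : ℚ) ≤ ((rankSet M 5).ncard : ℚ) := by exact_mod_cast hP4
  have hdc' : 2 * ((rankSet M 4).ncard : ℚ) ≤ (4 + 1) * ((rankSet M 5).ncard : ℚ) := by
    exact_mod_cast hdc
  have hf4 : (0 : ℚ) ≤ ((rankSet M 4).ncard : ℚ) := Nat.cast_nonneg _
  exact consumer_arith_eight_four_circuit_four hU' hP4' h53 hdc' hY' hf4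

/-- **The `5`-circuit consumer at `(8, 4)`**: `M` of rank `4`, `N` a `5`-circuit — by counting alone. -/
theorem c025_eight_four_disjointSum_circuit_five (M N : Matroid α) [M.Finite] [N.Finite]
    (h : Disjoint M.E N.E) (hM : M.eRank = ((4 : ℕ) : ℕ∞)) (hN : N.IsCircuit N.E) (hN5 : N.E.ncard = 5) :
    phiK 8 4 * ({A : Set α | A ⊆ (M.disjointSum N h).E ∧ (M.disjointSum N h).eRk A = ((8 : ℕ) : ℕ∞) ∧
        (M.disjointSum N h).eRk ((M.disjointSum N h).E \ A) = ((4 : ℕ) : ℕ∞)}.ncard : ℚ) ≤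
      ({A : Set α | A ⊆ (M.disjointSum N h).E ∧ ((4 : ℕ) : ℕ∞) < (M.disjointSum N h).eRk A ∧
        (M.disjointSum N h).eRk A < ((8 : ℕ) : ℕ∞)}.ncard : ℚ) := by
  have hU := ncard_U_disjointSum_circuit_le M N h (p := 8) (r := 4) (s := 4) rfl (by norm_num) hM hN hN5
  have hY := ncard_Y_eight_four_circuit_five_ge M N h hN hN5
  have hsum := ncard_profileSet_add_le_ncard_rankSet M 4 (b := 4) (b' := 3) (by norm_num)
  have hP3 := ncard_profileSet_le_ncard_rankSet_snd M 4 3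
  rw [phiK_eight_four]
  have hU' : (({A : Set α | A ⊆ (M.disjointSum N h).E ∧ (M.disjointSum N h).eRk A = ((8 : ℕ) : ℕ∞) ∧
      (M.disjointSum N h).eRk ((M.disjointSum N h).E \ A) = ((4 : ℕ) : ℕ∞)}.ncard : ℕ) : ℚ) ≤
      ((profileSet M 4 4).ncard : ℚ) + 5 * ((profileSet M 4 3).ncard : ℚ) := by
    have hU2 : ({A : Set α | A ⊆ (M.disjointSum N h).E ∧ (M.disjointSum N h).eRk A = ((8 : ℕ) : ℕ∞) ∧
        (M.disjointSum N h).eRk ((M.disjointSum N h).E \ A) = ((4 : ℕ) : ℕ∞)}.ncard : ℕ) ≤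
        (profileSet M 4 4).ncard + 5 * (profileSet M 4 3).ncard := hU
    exact_mod_cast hU2
  have hY' : 25 * ((rankSet M 4).ncard : ℚ) + 26 * ((rankSet M 3).ncard : ℚ) ≤
      (({A : Set α | A ⊆ (M.disjointSum N h).E ∧ ((4 : ℕ) : ℕ∞) < (M.disjointSum N h).eRk A ∧
        (M.disjointSum N h).eRk A < ((8 : ℕ) : ℕ∞)}.ncard : ℕ) : ℚ) := by
    exact_mod_cast hY
  have hsum' : ((profileSet M 4 4).ncard : ℚ) + ((profileSet M 4 3).ncard : ℚ) ≤ ((rankSet M 4).ncard : ℚ) := by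
    exact_mod_cast hsum
  have hP3' : ((profileSet M 4 3).ncard : ℚ) ≤ ((rankSet M 3).ncard : ℚ) := by exact_mod_cast hP3
  have hf4 : (0 : ℚ) ≤ ((rankSet M 4).ncard : ℚ) := Nat.cast_nonneg _
  have hf3 : (0 : ℚ) ≤ ((rankSet M 3).ncard : ℚ) := Nat.cast_nonneg _
  exact consumer_arith_eight_four_circuit_five hU' hsum' hP3' hY' hf4 hf3

/-- **The large-circuit consumer at `(8, 4)`**: `N` a circuit of `s + 1 ≥ 6` elements, `M` of rank
`r = 8 − s`. -/
theorem c025_eight_four_disjointSum_circuit_large (M N : Matroid α) [M.Finite] [N.Finite]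
    (h : Disjoint M.E N.E) {r s : ℕ} (hrs : r + s = 8) (hs : 5 ≤ s) (hM : M.eRank = r)
    (hN : N.IsCircuit N.E) (hNs : N.E.ncard = s + 1) :
    phiK 8 4 * ({A : Set α | A ⊆ (M.disjointSum N h).E ∧ (M.disjointSum N h).eRk A = ((8 : ℕ) : ℕ∞) ∧
        (M.disjointSum N h).eRk ((M.disjointSum N h).E \ A) = ((4 : ℕ) : ℕ∞)}.ncard : ℚ) ≤
      ({A : Set α | A ⊆ (M.disjointSum N h).E ∧ ((4 : ℕ) : ℕ∞) < (M.disjointSum N h).eRk A ∧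
        (M.disjointSum N h).eRk A < ((8 : ℕ) : ℕ∞)}.ncard : ℚ) := by
  have hU := ncard_U_disjointSum_circuit_le M N h hrs (by omega) hM hN hNs
  have hY := ncard_Y_eight_four_large_ge M N h hrs hs hN hNs
  have hb := binomial_sum_eight_four hs (by omega)
  have hsum := ncard_profileSet_add_le_ncard_rankSet M r (b := 4) (b' := 3) (by norm_num)
  have hkey : 76 * {A : Set α | A ⊆ (M.disjointSum N h).E ∧ (M.disjointSum N h).eRk A = ((8 : ℕ) : ℕ∞) ∧
        (M.disjointSum N h).eRk ((M.disjointSum N h).E \ A) = ((4 : ℕ) : ℕ∞)}.ncard ≤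
      15 * {A : Set α | A ⊆ (M.disjointSum N h).E ∧ ((4 : ℕ) : ℕ∞) < (M.disjointSum N h).eRk A ∧
        (M.disjointSum N h).eRk A < ((8 : ℕ) : ℕ∞)}.ncard := by
    calc 76 * {A : Set α | A ⊆ (M.disjointSum N h).E ∧ (M.disjointSum N h).eRk A = ((8 : ℕ) : ℕ∞) ∧
          (M.disjointSum N h).eRk ((M.disjointSum N h).E \ A) = ((4 : ℕ) : ℕ∞)}.ncard
        ≤ 76 * ((profileSet M r 4).ncard + (s + 1) * (profileSet M r 3).ncard) := Nat.mul_le_mul_left _ hU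
      _ ≤ 76 * ((s + 1) * ((profileSet M r 4).ncard + (profileSet M r 3).ncard)) := by
          apply Nat.mul_le_mul_left
          nlinarith
      _ ≤ 76 * ((s + 1) * (rankSet M r).ncard) :=
          Nat.mul_le_mul_left _ (Nat.mul_le_mul_left _ hsum)
      _ = (76 * (s + 1)) * (rankSet M r).ncard := by ring
      _ ≤ (15 * (Nat.choose (s + 1) (s - 3) + Nat.choose (s + 1) (s - 2) + Nat.choose (s + 1) (s - 1))) *
            (rankSet M r).ncard := Nat.mul_le_mul_right _ hb
      _ = 15 * ((rankSet M r).ncard * (Nat.choose (s + 1) (s - 3) + Nat.choose (s + 1) (s - 2) +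
            Nat.choose (s + 1) (s - 1))) := by ring
      _ ≤ 15 * {A : Set α | A ⊆ (M.disjointSum N h).E ∧ ((4 : ℕ) : ℕ∞) < (M.disjointSum N h).eRk A ∧
            (M.disjointSum N h).eRk A < ((8 : ℕ) : ℕ∞)}.ncard := Nat.mul_le_mul_left _ hY
  rw [phiK_eight_four]
  have hkey' : (76 : ℚ) * (({A : Set α | A ⊆ (M.disjointSum N h).E ∧
      (M.disjointSum N h).eRk A = ((8 : ℕ) : ℕ∞) ∧
      (M.disjointSum N h).eRk ((M.disjointSum N h).E \ A) = ((4 : ℕ) : ℕ∞)}.ncard : ℕ) : ℚ) ≤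
      15 * (({A : Set α | A ⊆ (M.disjointSum N h).E ∧ ((4 : ℕ) : ℕ∞) < (M.disjointSum N h).eRk A ∧
        (M.disjointSum N h).eRk A < ((8 : ℕ) : ℕ∞)}.ncard : ℕ) : ℚ) := by
    exact_mod_cast hkey
  exact consumer_arith_eight_four_large hkey'

/-- **EVERY CIRCUIT SUMMAND AT `(8, 4)`**: `Φ(8, 4) · #U(M ⊕ N; 8, 4) ≤ #Y(M ⊕ N; 8, 4)` for every finite
coloop-free `M` of rank `r` and every finite `N` whose ground set is a circuit of `s + 1 ≥ 3` elements with
`r + s = 8`. -/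
theorem c025_eight_four_disjointSum_circuit (M N : Matroid α) [M.Finite] [N.Finite]
    (h : Disjoint M.E N.E) {r s : ℕ} (hrs : r + s = 8) (hs : 2 ≤ s) (hM : M.eRank = r)
    (hcol : M.coloops = ∅) (hN : N.IsCircuit N.E) (hNs : N.E.ncard = s + 1) :
    phiK 8 4 * ({A : Set α | A ⊆ (M.disjointSum N h).E ∧ (M.disjointSum N h).eRk A = ((8 : ℕ) : ℕ∞) ∧
        (M.disjointSum N h).eRk ((M.disjointSum N h).E \ A) = ((4 : ℕ) : ℕ∞)}.ncard : ℚ) ≤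
      ({A : Set α | A ⊆ (M.disjointSum N h).E ∧ ((4 : ℕ) : ℕ∞) < (M.disjointSum N h).eRk A ∧
        (M.disjointSum N h).eRk A < ((8 : ℕ) : ℕ∞)}.ncard : ℚ) := by
  rcases Nat.lt_or_ge s 5 with hs5 | hs5
  · rcases Nat.lt_or_ge s 3 with hs3 | hs3
    · have hs2 : s = 2 := by omega
      subst hs2
      have hr : r = 6 := by omega
      subst hr
      exact c025_eight_four_disjointSum_triangle M N h hM hcol hN hNs
    rcases Nat.lt_or_ge s 4 with hs4 | hs4
    · have hs3' : s = 3 := by omega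
      subst hs3'
      have hr : r = 5 := by omega
      subst hr
      exact c025_eight_four_disjointSum_circuit_four M N h hM hcol hN hNs
    · have hs4' : s = 4 := by omega
      subst hs4'
      have hr : r = 4 := by omega
      subst hr
      exact c025_eight_four_disjointSum_circuit_five M N h hM hN hNs
  · exact c025_eight_four_disjointSum_circuit_large M N h hrs hs5 hM hN hNs

end S1

end PercRepro
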